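import Summits.NavierStokesRegularity.NavierStokesRegularity.Theorems.IsotropicBlobWitnessAssembly
import Summits.NavierStokesRegularity.NavierStokesRegularity.Theorems.IsotropicBlobWitnessFieldSource
import Summits.NavierStokesRegularity.NavierStokesRegularity.Theorems.IsotropicBlobPoissonUnique
import HarnessLib

/-!
# IsotropicBlobWitness — ★ THE `C²` SUB-PARITY WITNESS OF ROUND-41 BY NAME: `SubParityWitnessOf 2 (9/14)` and
# `¬ ArgmaxFeedParityOf 2` (τ1 «feed parity at every global strain argmax» is FALSE for `C²` fields)

nsreg-p1 g33's ROUND-41 «IsotropicBlobPressureLaw ⇒ ParityByShape ⇒ SubParityWitness» (Sketch45 04c680584730f646,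
texts `IsotropicBlobDefs`) and ROUND-42 «ArgmaxCertificate» (Sketch46/ArgmaxCover47), closed in the kernel by the S-door
lane (LEAD ns-s30-p1 g4; ns-s29-p2 g5; ns-sfl-p1 g6):

* the field `u = witnessFieldC2` = the uniaxial isotropic blob with envelope `(1−|x|²)₊⁴` — `C²`, compactly supported,
  divergence-free (`IsotropicBlobWitnessField{,Deriv,Regularity,Source}`, sfl);
* the pressure `p = witnessPressure = Φ₀(‖x‖²) + Φ₂(‖x‖²)Z₂ + Φ₄(‖x‖²)Z₄` with the glued 1-D profiles of r41/glue1d_k4.txt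
  (`IsotropicBlob{Profiles,PressureProfiles,PressurePoisson}`, s29-p2; plates L/P/R/Z/W2, LEAD+s29-p2): `C²`,
  `Δp = −tr((∇u)²)` EVERYWHERE (three 1-D Poisson identities + the trace identity), `p → 0` at infinity — i.e.
  `IsDecayingPressureOf u p`, and by plate E3 THE ONLY such pressure (`eq_witnessPressure_of_isDecayingPressureOf`);
* `(0, e₃)` is a GLOBAL strain argmax with `Λ = 1` (W3: p1's 21 kernel-`decide`d Bernstein box certificates + division-free
  Sylvester, `IsotropicBlobArgmaxCert/Cover`, landed by s29-p2; identification `⟪∇u(y)e,e⟫ = strainFormC2`, sfl);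
* the centre feed is `H = ¼(|ω|²−ω_e²) − ∇²p(e₃,e₃) = 0 − (−9/14) = 9/14 = (9/14)·Λ²` (`IsotropicBlobPressureHessian`).

Hence `subParityWitnessOf_two : SubParityWitnessOf 2 (9/14)` and `not_argmaxFeedParityOf_two : ¬ ArgmaxFeedParityOf 2`
(and `¬ ArgmaxFeedParityOf n` for every `n ≤ 2`).  τ1 PROPER (`n = ⊤`, smooth fields) is NOT refuted here (the `C^∞`
bump witness of ROUND-41 is numerical); feed parity IS restored by super-parity shapes (p1 §11), so the S40/S41 parity
hypotheses are genuine dynamical hypotheses, not kinematic facts — which is what this certificate settles.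
`--supports stmt-NavierStokesRegularity-0056 --as helper`.
HONEST FRAME: a kinematic slice statement about ONE explicit compactly supported field; items 0056 `NoTypeII`, 10661 and
NS regularity are NOT proved; no hard core is touched; nothing here is a route or a summit statement.
-/

set_option linter.dupNamespace false

open Set Function Filter Topology InnerProductSpace
open scoped RealInnerProductSpace Laplacian ContDiff

namespace Summit.NavierStokesRegularity.NavierStokesRegularity.Theorems.StrainDoors

namespace IsotropicBlob

open HarmonicShell Literature.Analysis Literature.Analysis.FluidPDE VectorCalculus
open Summit.NavierStokesRegularity.NavierStokesRegularity.Theorems.ArgmaxDoors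

noncomputable section

/-- **The global strain bound at unit directions**: `⟪∇u(y)e,e⟫ ≤ 1 = Λ` for every `y` and every unit `e`
(W3 by name: `inner_fderiv_witnessFieldC2_le_norm_sq`). -/
theorem inner_fderiv_witnessFieldC2_le_one (y e : EuclideanSpace ℝ (Fin 3)) (he : ‖e‖ = 1) :
    ⟪fderiv ℝ witnessFieldC2 y e, e⟫ ≤ 1 := by
  have h := inner_fderiv_witnessFieldC2_le_norm_sq y e
  rw [he, one_pow] at h
  exact h

/-- **The witness pressure is the decaying pressure of the witness field** (trace identity by name). -/
theorem isDecayingPressureOf_witness : IsDecayingPressureOf witnessFieldC2 witnessPressure :=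
  isDecayingPressureOf_witness_of neg_traceCLM_fderiv_sq_witnessFieldC2

/-- **…and it is THE decaying pressure**: any `IsDecayingPressureOf witnessFieldC2 p` equals `witnessPressure`
(plate E3 `HarmonicShell.eq_of_laplacian_eq_of_tendsto_cocompact`). -/
theorem eq_witnessPressure_of_isDecayingPressureOf {p : EuclideanSpace ℝ (Fin 3) → ℝ}
    (hp : IsDecayingPressureOf witnessFieldC2 p) : p = witnessPressure :=
  HarmonicShell.eq_of_laplacian_eq_of_tendsto_cocompact hp.1 contDiff_witnessPressure
    (fun x => by rw [hp.2.1 x, isDecayingPressureOf_witness.2.1 x]) hp.2.2 tendsto_witnessPressure_cocompact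

/-- **`(0, e₃)` is a global strain argmax of the witness field.** -/
theorem isStrainArgmax_witness : IsStrainArgmax (fun _ => witnessFieldC2) 0 0 (EuclideanSpace.single 2 1) :=
  isStrainArgmax_witness_of inner_fderiv_witnessFieldC2_le_one

/-- ★ **THE `C²` SUB-PARITY WITNESS** (ROUND-41, Sketch45's `SubParityWitnessOf` VERBATIM): a `C²`, compactly supported,
divergence-free slice field whose decaying pressure gives feed ratio EXACTLY `9/14` at a genuine global strain argmax
with `Λ = 1 > 0`. -/
theorem subParityWitnessOf_two : SubParityWitnessOf 2 (9 / 14) :=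
  subParityWitnessOf_two_of contDiff_two_witnessFieldC2 isDivFree_witnessFieldC2 neg_traceCLM_fderiv_sq_witnessFieldC2
    inner_fderiv_witnessFieldC2_le_one

/-- The witness at every regularity `n ≤ 2`. -/
theorem subParityWitnessOf_of_le_two {n : ℕ∞} (hn : n ≤ 2) : SubParityWitnessOf n (9 / 14) :=
  subParityWitnessOf_mono hn subParityWitnessOf_two

/-- ★ **τ1 AT REGULARITY 2 IS FALSE**: feed parity `Λ² ≤ H` does NOT hold at every global strain argmax of every `C²`
compactly supported divergence-free field with its decaying pressure (`9/14 < 1`). -/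
theorem not_argmaxFeedParityOf_two : ¬ ArgmaxFeedParityOf 2 :=
  not_argmaxFeedParityOf_of_witness (by norm_num) subParityWitnessOf_two

/-- τ1 is false at every regularity `n ≤ 2` (parity for rougher fields implies parity for smoother ones). -/
theorem not_argmaxFeedParityOf_of_le_two {n : ℕ∞} (hn : n ≤ 2) : ¬ ArgmaxFeedParityOf n :=
  fun h => not_argmaxFeedParityOf_two (argmaxFeedParityOf_mono hn h)

end

end IsotropicBlob

end Summit.NavierStokesRegularity.NavierStokesRegularity.Theorems.StrainDoors
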